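import Summits.SmoothPoincare4.SmoothPoincare4.Theorems.EntropyRungCompactShrinkerGapWeightedHessianEnergy
import Summits.SmoothPoincare4.SmoothPoincare4.Theorems.EntropyRungCompactShrinkerGapScalarIdentities
import Summits.SmoothPoincare4.SmoothPoincare4.Theorems.EntropyRungCompactShrinkerGapNormSqHessian
import Summits.SmoothPoincare4.SmoothPoincare4.Theorems.EntropyRungCompactShrinkerGapWeightedDirichlet
import Summits.SmoothPoincare4.SmoothPoincare4.Theorems.EntropyRungCompactShrinkerGapScalarCurvaturePos
import HarnessLib

/-!
# The weighted Einstein defect of a closed normalised 4-d gradient shrinker is at most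
`2e^{-2}` times its Jensen gap
(registered helper `helper_weightedHessianEnergy_le_jensenGap` of line `cgy-variance-pivot`, crux
`EntropyRung.CompactShrinkerGap`, item stmt-SmoothPoincare4-10870)

For a Riemannian metric `g` (Levi-Civita connection) on a closed `4`-manifold and a smooth `f`
with `Ric + Hess f = g/2` and `R + |∇f|² = f` (a normalised gradient shrinker, `τ = 1`), the
weighted "Einstein defect" `∫|Hess f|² e^{-f} dV = ∫|Ric − g/2|² e^{-f} dV` is controlled by the
Jensen gap `Vol(M,g) − e² Z`, `Z = ∫ e^{-f} dV ≤ e^{-2} Vol(M,g)` (`stub_jensenVolumeBound`):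

  `∫_M |Hess f|² e^{-f} dV ≤ 2e^{-2} (Vol(M,g) − e² ∫_M e^{-f} dV)`.

Both sides vanish exactly in the Einstein case `f ≡ 2` (round `S⁴(√6)`: `0 ≤ 0`).

Proof (every ingredient is a landed tree theorem; here only real analysis and integral
bookkeeping on a compact manifold of finite volume):
* `∫|Hess f|² e^{-f} = ½ ∫|∇f|² e^{-f}` (`stub_weightedHessianEnergy_of_identities`, fed with the
  identity (B) `ΔR = g⁻¹(dR, df) + R − 2|Ric|²` of `stub_shrinkerScalarIdentities` and the pointwise
  `|Hess f|² = |Ric|² + 1 − R` of `stub_normSqHessian`; Cao–Zhu 2010, (3.6)–(3.7));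
* `∫|∇f|² e^{-f} = ∫(f − 2)² e^{-f}` (`stub_weightedDirichlet`);
* `R > 0` on the closed shrinker (`stub_scalarCurvaturePos_of_identities`), so `f = R + |∇f|² > 0`;
* the elementary inequality `t² ≤ 4e^{t−2}` for `t ≥ 0` (square `t/2 ≤ e^{t/2 − 1}`, i.e.
  `1 + u ≤ eᵘ`), in the form `(t − 2)² e^{-t} ≤ 4e^{-2} − 4t e^{-t} + 4e^{-t}`
  (`sub_two_sq_mul_exp_neg_le`), applied with `t = f(x)` and integrated:
  `∫(f − 2)² e^{-f} ≤ 4e^{-2} Vol − 4∫ f e^{-f} + 4Z = 4e^{-2} Vol − 4Z`, using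
  `∫ f e^{-f} = 2Z` (`integral_mul_exp_neg_eq_two_mul`, Cao–Hamilton–Ilmanen 2004, §4).
Combining, `∫|Hess f|² e^{-f} ≤ 2e^{-2} Vol − 2Z = 2e^{-2}(Vol − e² Z)`.
Everything is proved; no definition, no named fact.

References: H.-D. Cao, M. Zhu, arXiv:1008.0842, (3.6)–(3.7) [CaoZhu2010]; H.-D. Cao,
R. S. Hamilton, T. Ilmanen, arXiv:math/0404165, §4 [CaoHamiltonIlmanen2004]; J. A. Carrillo, L. Ni,
Comm. Anal. Geom. 17 (2009), §4 [CarrilloNi2009].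
-/

noncomputable section

-- the registered namespace `Summit.SmoothPoincare4.SmoothPoincare4.Theorems` repeats a component
set_option linter.dupNamespace false

open Bundle Set Function Filter Module MeasureTheory
open scoped Manifold ContDiff Topology

namespace Summit.SmoothPoincare4.SmoothPoincare4.Theorems

open Literature.Geometry Literature.Geometry.Lorentzian Literature.Geometry.Riemannian
  Literature.Geometry.Lorentzian.PseudoRiemannianMetric

/-- **Elementary inequality** behind the weighted Einstein-defect bound: for `t ≥ 0`,
`(t − 2)² e^{-t} ≤ 4e^{-2} − 4t e^{-t} + 4e^{-t}`, i.e. `t² ≤ 4e^{t−2}`, the square of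
`t/2 ≤ e^{t/2 − 1}` (`1 + u ≤ eᵘ` at `u = t/2 − 1`); equality at `t = 2`. [folklore] -/
theorem sub_two_sq_mul_exp_neg_le {t : ℝ} (ht : 0 ≤ t) :
    (t - 2) ^ 2 * Real.exp (-t) ≤
      4 * Real.exp (-2) - 4 * (t * Real.exp (-t)) + 4 * Real.exp (-t) := by
  -- `t/2 ≤ e^{t/2 − 1}`
  have h1 : t / 2 ≤ Real.exp (t / 2 - 1) := by
    have h := Real.add_one_le_exp (t / 2 - 1)
    linarith
  -- square it: `t²/4 ≤ e^{t − 2}`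
  have h2 : (t / 2) ^ 2 ≤ Real.exp (t / 2 - 1) ^ 2 :=
    pow_le_pow_left₀ (by positivity) h1 2
  have h3 : Real.exp (t / 2 - 1) ^ 2 = Real.exp (t - 2) := by
    rw [sq, ← Real.exp_add]
    congr 1
    ring
  rw [h3] at h2
  -- multiply by `e^{-t} > 0` and use `e^{t−2} e^{-t} = e^{-2}`
  have he : 0 < Real.exp (-t) := Real.exp_pos _
  have h4 : Real.exp (t - 2) * Real.exp (-t) = Real.exp (-2) := by
    rw [← Real.exp_add]
    congr 1
    ring
  nlinarith [mul_le_mul_of_nonneg_right h2 he.le, h4]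

/-- **Registered helper `helper_weightedHessianEnergy_le_jensenGap` of line `cgy-variance-pivot` —
the weighted Einstein defect is at most `2e^{-2}` times the Jensen gap.** For `g` Riemannian
(Levi-Civita) on a closed 4-manifold and `f` smooth with `Ric + Hess f = g/2`, `R + |∇f|² = f`:
`∫|Hess f|² e^{-f} dV ≤ 2e^{-2}(Vol(M,g) − e² ∫ e^{-f} dV)`. Proof:
`∫|Hess f|² e^{-f} = ½∫|∇f|² e^{-f}` (`stub_weightedHessianEnergy_of_identities` with (B) of
`stub_shrinkerScalarIdentities` and `stub_normSqHessian`) `= ½∫(f − 2)² e^{-f}`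
(`stub_weightedDirichlet`); `f = R + |∇f|² > 0` (`stub_scalarCurvaturePos_of_identities`,
`gradSq_nonneg`), so pointwise `(f − 2)² e^{-f} ≤ 4e^{-2} − 4f e^{-f} + 4e^{-f}`
(`sub_two_sq_mul_exp_neg_le`); integrate over the compact `M` and use `∫ f e^{-f} = 2∫ e^{-f}`
(`integral_mul_exp_neg_eq_two_mul`): `∫(f − 2)² e^{-f} ≤ 4e^{-2} Vol − 4∫ e^{-f}`. Check: round
`S⁴(√6)`, `f ≡ 2`: `0 ≤ 2e^{-2}(96π² − e²·96π²e^{-2}) = 0`.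
[cite: CaoZhu2010, (3.6)–(3.7)] [cite: CaoHamiltonIlmanen2004, §4] -/
theorem helper_weightedHessianEnergy_le_jensenGap :
    ∀ (M : Type) [TopologicalSpace M] [T2Space M] [SecondCountableTopology M]
      [ChartedSpace (EuclideanSpace ℝ (Fin 4)) M] [IsManifold (𝓡 4) ∞ M] [CompactSpace M]
      [T3Space M] [MeasurableSpace M] [BorelSpace M]
      (g : Literature.Geometry.Lorentzian.PseudoRiemannianMetric (𝓡 4) ∞ (EuclideanSpace ℝ (Fin 4))
        (TangentSpace (𝓡 4) : M → Type _)) [g.HasLeviCivita] (f : M → ℝ) (hg : g.IsRiemannian),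
      ContMDiff (𝓡 4) 𝓘(ℝ, ℝ) ∞ f →
      (∀ (x : M) (X Y : TangentSpace (𝓡 4) x),
        g.ricci x X Y + g.hessian f x X Y = (1 / 2 : ℝ) * g.val x X Y) →
      (∀ x : M, g.scalarCurvature x + g.gradSq f x = f x) →
      ∫ x, g.normSq x (g.hessian f x) * Real.exp (-f x)
          ∂(Literature.Geometry.Lorentzian.riemannianMeasure (g.toContMDiffRiemannianMetric hg)) ≤
        2 * Real.exp (-2) *
          (((Literature.Geometry.Lorentzian.riemannianMeasure (g.toContMDiffRiemannianMetric hg))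
              Set.univ).toReal -
            Real.exp 2 * ∫ x, Real.exp (-f x)
              ∂(Literature.Geometry.Lorentzian.riemannianMeasure
                (g.toContMDiffRiemannianMetric hg))) := by
  intro M _ _ _ _ _ _ _ _ _ g _ f hg hf hsol hnorm
  -- the landed identities: (B), (H), the weighted Bochner identity, W1, C3, and `R > 0`
  have hB := (stub_shrinkerScalarIdentities M g f hg hf hsol).2
  have hH := stub_normSqHessian M g f hg hsol
  have hHess := stub_weightedHessianEnergy_of_identities M g f hg hf hsol hnorm hB hH
  have hW1 := stub_weightedDirichlet M g f hg hf hsol hnorm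
  have hC3 := integral_mul_exp_neg_eq_two_mul M g f hg hf hsol hnorm
  have hR : ∀ x : M, 0 < g.scalarCurvature x :=
    stub_scalarCurvaturePos_of_identities M g f hg hf hsol hB
  -- `f = R + |∇f|² > 0`
  have hf0 : ∀ x, 0 < f x := fun x ↦ by
    have h := hnorm x
    linarith [hR x, g.gradSq_nonneg hg f x]
  -- the Riemannian measure is `g.riemVolume`, a finite measure
  have hV : g.riemVolume = riemannianMeasure (g.toContMDiffRiemannianMetric hg) :=
    PseudoRiemannianMetric.riemVolume_eq hg
  rw [← hV] at hHess hW1 hC3 ⊢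
  haveI : IsFiniteMeasure g.riemVolume := ⟨g.riemVolume_univ_lt_top⟩
  -- integrability of the (continuous) integrands
  have hec : Continuous fun x ↦ Real.exp (-f x) := Real.continuous_exp.comp hf.continuous.neg
  have ie : Integrable (fun x ↦ Real.exp (-f x)) g.riemVolume := g.integrable_of_continuous hec
  have ife : Integrable (fun x ↦ f x * Real.exp (-f x)) g.riemVolume :=
    g.integrable_of_continuous (hf.continuous.mul hec)
  have iS : Integrable (fun x ↦ (f x - 2) ^ 2 * Real.exp (-f x)) g.riemVolume :=
    g.integrable_of_continuous (((hf.continuous.sub continuous_const).pow 2).mul hec)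
  have iK : Integrable (fun _ : M ↦ (4 * Real.exp (-2) : ℝ)) g.riemVolume := integrable_const _
  have iD : Integrable (fun x ↦ 4 * Real.exp (-2) - 4 * (f x * Real.exp (-f x))) g.riemVolume :=
    iK.sub (ife.const_mul 4)
  have iRHS : Integrable
      (fun x ↦ 4 * Real.exp (-2) - 4 * (f x * Real.exp (-f x)) + 4 * Real.exp (-f x))
      g.riemVolume := iD.add (ie.const_mul 4)
  -- integrate the pointwise inequality `(f − 2)² e^{-f} ≤ 4e^{-2} − 4 f e^{-f} + 4 e^{-f}`
  have hmono : ∫ x, (f x - 2) ^ 2 * Real.exp (-f x) ∂g.riemVolume ≤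
      ∫ x, (4 * Real.exp (-2) - 4 * (f x * Real.exp (-f x)) + 4 * Real.exp (-f x))
        ∂g.riemVolume :=
    integral_mono iS iRHS fun x ↦ sub_two_sq_mul_exp_neg_le (hf0 x).le
  have hRHS : ∫ x, (4 * Real.exp (-2) - 4 * (f x * Real.exp (-f x)) + 4 * Real.exp (-f x))
        ∂g.riemVolume =
      4 * Real.exp (-2) * (g.riemVolume Set.univ).toReal -
        4 * ∫ x, f x * Real.exp (-f x) ∂g.riemVolume + 4 * ∫ x, Real.exp (-f x) ∂g.riemVolume := by
    rw [integral_add iD (ie.const_mul 4), integral_sub iK (ife.const_mul 4), integral_const_mul,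
      integral_const_mul, integral_const_mul, integral_const, smul_eq_mul, Measure.real]
    ring
  -- `e^{-2} e² = 1`
  have h5 : Real.exp (-2) * Real.exp 2 = 1 := by
    rw [← Real.exp_add]
    norm_num
  have hrhs : 2 * Real.exp (-2) * ((g.riemVolume Set.univ).toReal -
      Real.exp 2 * ∫ x, Real.exp (-f x) ∂g.riemVolume) =
      2 * Real.exp (-2) * (g.riemVolume Set.univ).toReal -
        2 * ∫ x, Real.exp (-f x) ∂g.riemVolume := by
    linear_combination (-2 * ∫ x, Real.exp (-f x) ∂g.riemVolume) * h5
  rw [hrhs, hHess, hW1]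
  linarith [hmono, hRHS, hC3]

end Summit.SmoothPoincare4.SmoothPoincare4.Theorems

end
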